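import Summits.CriticalPhenomena.PercolationContinuityZ3.Theorems.PercNearOneGluingNoHeavyQuantCrossingCubeBridge
import HarnessLib
/-!
# The derivative of the annulus-crossing probability is controlled by the ONE-ARM probability (Dewan–Muirhead's
# revealment bound, Prop. 2.2, for `u_p(L,N) = P_p(Λ(L) ↔ ∂ⁱⁿΛ(N) in Λ(N))` on `ℤ^d`)

builds on p205010 (kernel theorem, internal audit signed; external expert review pending) — NOT used in this file.

QUANT lane (`prim-quant`), seat p4 (METHOD: differential inequalities for `θ` near `p_c`), gen 14; helper file
`--supports stmt-CriticalPhenomena-4575`; pure proofs, no definitions, no sorries.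

V. Dewan, S. Muirhead, PTRF (2022) [arXiv:2102.12123], Prop. 2.2: `d/dp P_p[Cross_k(R)] ≤ c R^{d/2} √(P_p[A_1(R)])/√(p(1−p))`,
proved there from the relative-entropy bound (2.8) `|∑_{e∈E'} ∂_e P_p[A]| ≤ √(P_p[A]·E_p|W_{E'}|/(p(1−p)))` and Lemma 2.9
(exploring the clusters of a face of the box reveals an edge of the far half with probability `≤ 2P_p[A_1(R)]`), the
near half being handled by symmetry.  This file proves the same bound for the lane's ANNULUS crossing
`boxCrossing d L N = {Λ(L) ↔ ∂ⁱⁿΛ(N) in Λ(N)}` (`SurfaceTension.boxCrossing`), with the O'Donnell–Servedio variance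
route of `Literature/…/OSInequality.lean` and the seed explorations of Duminil-Copin–Raoufi–Tassion
(`SeedExploration.lean`, `SeedCrossingRevealment.lean`) in place of relative entropy (part 2 of 2; the cube reading of the
crossing and the bridges are part 1, `…QuantCrossingCubeBridge.lean`): the crossing is the event
`∂Λ_L ↔ ∂Λ_N` of the box cube `Λ(N)` (`sconn_iff_mem_boxCrossing`); exploring from the INNER sphere `∂Λ_L` reveals a
pair `{a,b}` with probability `≤ θ_{|‖a‖−L|} + θ_{|‖b‖−L|}` and exploring from the OUTER sphere `∂Λ_N` with probability
`≤ θ_{N−‖a‖} + θ_{N−‖b‖}` (`OneArmOSSS.seedProb_sphereSeed_le`); splitting the pairs of `Λ(N)` at the norm `M`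
(Dewan–Muirhead's two halves) every pair is revealed by one of the two trees with probability `≤ 2θ_m`,
`m = min(N−M−1, M+1−L)`.  Main results (every `d ≥ 1`, `L ≤ M`, `M + 1 ≤ N`, `p ∈ (0,1)`; `θ_m = DCT16.thetaN d m`):

* `sum_pivotal_boxCrossing_le` — **`∑_{e ⊆ Λ(N)} P_p(e pivotal for boxCrossing d L N) ≤ 2·√( u(1−u) · 4d(2N+1)^d · θ_m(p) / (p(1−p)) )`**,
  `u = P_p(boxCrossing d L N)`;
* `hasDerivAt_real_boxCrossing_le` — Russo: the left side is `(d/dp) u_p(L,N)`.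

Compare the Moore–Shannon/CCFS bound `√(m·u(1−u)/(p(1−p)))`, `m = #edges ≤ 2d(2N+1)^d`, of lane 3
(`Crossing.sqrt_real_boxCrossing_le`): the edge count is multiplied by the one-arm probability `16·θ_m(p)`.  The integrated
forms, the near-critical WINDOW and the correlation-length readings are in `…QuantCrossingWindowOneArm.lean`.
-/

noncomputable section

namespace Summit.CriticalPhenomena.PercolationContinuityZ3.Theorems.CrossingRevealment

open MeasureTheory Finset Function
open Literature.Probability.Percolation Literature.Probability.LatticeModels
open Literature.Probability.ODonnellSaksSchrammServedio2005
open Literature.Probability.Percolation.GhostExploration Literature.Probability.Percolation.SeedExploration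
open Literature.Probability.Percolation.OneArmOSSS Literature.Probability.Percolation.DCT16
open Summit.CriticalPhenomena.PercolationContinuityZ3.Theorems.SurfaceTension
open Summit.CriticalPhenomena.PercolationContinuityZ3.Theorems.Crossing

variable {d : ℕ}

/-! ### §3. Revealment majorants: the two spheres and the zone split -/

/-- `θ_j(p) = P_p(0 ↔ ∂Λ_j)` is antitone in `j` and `Nat.dist k n ≥ k − n`: a revealment bound `θ_{|k − n|}` is at most
`θ_j` whenever `j + n ≤ k`. [cite: DewanMuirhead2022, §2 Lemma 2.9 (Rev(e) ≤ 2P_p[A_1(R)] on the far half)] -/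
theorem real_siteToBoundary_dist_le (p : unitInterval) {k n j : ℕ} (h : j + n ≤ k) :
    (bondPercolation (zdGraph d) p).real (siteToBoundary d (Nat.dist k n))
      ≤ (bondPercolation (zdGraph d) p).real (siteToBoundary d j) := by
  refine real_siteToBoundary_antitone p ?_
  unfold Nat.dist; omega

/-- The same with the roles reversed: `θ_{|k − n|} ≤ θ_j` whenever `j + k ≤ n`.
[cite: DewanMuirhead2022, §2 Lemma 2.9 (Rev(e) ≤ 2P_p[A_1(R)] on the far half)] -/
theorem real_siteToBoundary_dist_le' (p : unitInterval) {k n j : ℕ} (h : j + k ≤ n) :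
    (bondPercolation (zdGraph d) p).real (siteToBoundary d (Nat.dist k n))
      ≤ (bondPercolation (zdGraph d) p).real (siteToBoundary d j) := by
  refine real_siteToBoundary_antitone p ?_
  unfold Nat.dist; omega

/-- The INNER ZONE of pairs of `Λ(N)`: some endpoint has sup norm `≤ M` (Dewan–Muirhead's half of the box).
[cite: DewanMuirhead2022, §2 Lemma 2.9 (the half B_k^+(R))] -/
theorem mem_innerZone_iff {N M : ℕ} (e : PairIdx d N) :
    e ∈ (Finset.univ.filter fun e : PairIdx d N => ∃ a ∈ box d N, a ∈ e.1 ∧ boxNorm a ≤ M)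
      ↔ ∃ a ∈ box d N, a ∈ e.1 ∧ boxNorm a ≤ M := by
  simp only [Finset.mem_filter, Finset.mem_univ, true_and]

/-- OUTER TREE ON THE INNER ZONE: for a lattice pair `e = {a,b}` with an endpoint of norm `≤ M` (`M + 1 ≤ N`), the
exploration from the outer sphere `∂Λ_N` reveals `e` with probability `≤ 2θ_{N−M−1}`:
`P(a ↔ ∂Λ_N) + P(b ↔ ∂Λ_N) ≤ 2θ_{N−M−1}`. [cite: DewanMuirhead2022, §2 Lemma 2.9 (max_{e ∈ far half} Rev(e) ≤ 2P_p[A_1(R)])] -/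
theorem seedProb_outer_le (hd : 1 ≤ d) {N M : ℕ} (hMN : M + 1 ≤ N) (p : unitInterval) {e : PairIdx d N}
    (he : ∃ a ∈ box d N, a ∈ e.1 ∧ boxNorm a ≤ M) {a b : BoxV d N} (hab : latEdge d N a b = some e) :
    seedProb (latEdge d N) (boxBias d N p) (sphereSeed d N N) a
        + seedProb (latEdge d N) (boxBias d N p) (sphereSeed d N N) b
      ≤ 2 * (bondPercolation (zdGraph d) p).real (siteToBoundary d (N - M - 1)) := by
  obtain ⟨hadj, he1⟩ := latEdge_eq_some_iff.1 hab
  obtain ⟨c, _, hc, hcM⟩ := he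
  rw [he1, Sym2.mem_iff] at hc
  -- both endpoints have norm `≤ M + 1`
  have hna : boxNorm a.1 ≤ M + 1 := by
    rcases hc with rfl | rfl
    · omega
    · have := boxNorm_le_succ_of_adj hadj.symm; omega
  have hnb : boxNorm b.1 ≤ M + 1 := by
    rcases hc with rfl | rfl
    · have := boxNorm_le_succ_of_adj hadj; omega
    · omega
  have h1 := (seedProb_sphereSeed_le hd N p N a).trans
    (real_siteToBoundary_dist_le (d := d) p (k := N) (n := boxNorm a.1) (j := N - M - 1) (by omega))
  have h2 := (seedProb_sphereSeed_le hd N p N b).trans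
    (real_siteToBoundary_dist_le (d := d) p (k := N) (n := boxNorm b.1) (j := N - M - 1) (by omega))
  linarith

/-- INNER TREE ON THE OUTER ZONE: for a lattice pair `e = {a,b}` with both endpoints of norm `> M` (`L ≤ M`), the
exploration from the inner sphere `∂Λ_L` reveals `e` with probability `≤ 2θ_{M+1−L}`.
[cite: DewanMuirhead2022, §2 Lemma 2.9 (max_{e ∈ far half} Rev(e) ≤ 2P_p[A_1(R)])] -/
theorem seedProb_inner_le (hd : 1 ≤ d) {L N M : ℕ} (hLM : L ≤ M) (p : unitInterval) {e : PairIdx d N}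
    (he : ¬ ∃ a ∈ box d N, a ∈ e.1 ∧ boxNorm a ≤ M) {a b : BoxV d N} (hab : latEdge d N a b = some e) :
    seedProb (latEdge d N) (boxBias d N p) (sphereSeed d N L) a
        + seedProb (latEdge d N) (boxBias d N p) (sphereSeed d N L) b
      ≤ 2 * (bondPercolation (zdGraph d) p).real (siteToBoundary d (M + 1 - L)) := by
  obtain ⟨_, he1⟩ := latEdge_eq_some_iff.1 hab
  push Not at he
  have hna : M < boxNorm a.1 := he a.1 a.2 (by rw [he1]; exact Sym2.mem_mk_left _ _)
  have hnb : M < boxNorm b.1 := he b.1 b.2 (by rw [he1]; exact Sym2.mem_mk_right _ _)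
  have h1 := (seedProb_sphereSeed_le hd N p L a).trans
    (real_siteToBoundary_dist_le' (d := d) p (k := L) (n := boxNorm a.1) (j := M + 1 - L) (by omega))
  have h2 := (seedProb_sphereSeed_le hd N p L b).trans
    (real_siteToBoundary_dist_le' (d := d) p (k := L) (n := boxNorm b.1) (j := M + 1 - L) (by omega))
  linarith

/-- The total bias weight of the box cube: `∑_e b_e(1 − b_e) = p(1−p)·#{lattice edges inside Λ(N)} ≤ p(1−p)·2d(2N+1)^d`.
[cite: DewanMuirhead2022, §2 proof of Prop. 2.2 (E_p|W_{E'}| ≤ |B_k^+(R)| · max Rev)] -/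
theorem sum_bias_mul_le (N : ℕ) (p : unitInterval) (J : Finset (PairIdx d N)) :
    ∑ e ∈ J, boxBias d N p e * (1 - boxBias d N p e) ≤ (p : ℝ) * (1 - p) * (2 * d * (2 * (N : ℝ) + 1) ^ d) := by
  classical
  have hp0 : 0 ≤ (p : ℝ) := p.2.1
  have hp1 : (p : ℝ) ≤ 1 := p.2.2
  have hterm : ∀ e : PairIdx d N, boxBias d N p e * (1 - boxBias d N p e)
      = (p : ℝ) * (1 - p) * (if e.1 ∈ (zdGraph d).edgeSet then 1 else 0) := by
    intro e; unfold boxBias; split_ifs <;> ring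
  calc ∑ e ∈ J, boxBias d N p e * (1 - boxBias d N p e)
      ≤ ∑ e : PairIdx d N, boxBias d N p e * (1 - boxBias d N p e) :=
        Finset.sum_le_sum_of_subset_of_nonneg (Finset.subset_univ J) fun e _ _ =>
          mul_nonneg (boxBias_nonneg N hp0 e) (by linarith [boxBias_le_one N hp1 e])
    _ = (p : ℝ) * (1 - p) * ∑ z ∈ (box d N).sym2, (if z ∈ (zdGraph d).edgeSet then (1 : ℝ) else 0) := by
        rw [Finset.mul_sum, ← Finset.sum_coe_sort (box d N).sym2]
        exact Finset.sum_congr rfl fun e _ => hterm e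
    _ = (p : ℝ) * (1 - p) * (((box d N).sym2.filter (· ∈ (zdGraph d).edgeSet)).card : ℝ) := by
        rw [Finset.sum_boole]
    _ ≤ (p : ℝ) * (1 - p) * (2 * d * (2 * (N : ℝ) + 1) ^ d) := by
        refine mul_le_mul_of_nonneg_left ?_ (mul_nonneg hp0 (by linarith))
        calc (((box d N).sym2.filter (· ∈ (zdGraph d).edgeSet)).card : ℝ) ≤ 2 * d * (box d N).card := by
              exact_mod_cast card_sym2_filter_edgeSet_le (d := d) (box d N)
          _ = 2 * d * (2 * (N : ℝ) + 1) ^ d := by rw [card_box]; push_cast; ring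

/-! ### §4. The revealment bound for the pivotal sum of the annulus crossing -/

/-- **DEWAN–MUIRHEAD'S BOUND FOR THE ANNULUS CROSSING** (sum of pivotal probabilities).  For `d ≥ 1`, `L ≤ M`,
`M + 1 ≤ N`, `p ∈ (0,1)`, with `u = P_p(boxCrossing d L N)` and `m = min(N − M − 1, M + 1 − L)`:
`∑_{e ⊆ Λ(N)} P_p(e ∈ E(ℤ^d), e pivotal for boxCrossing d L N) ≤ 2·√( u(1−u) · (4d(2N+1)^d) · θ_m(p) / (p(1−p)) )`.
Proof: split the pairs of `Λ(N)` into the inner zone (an endpoint of norm `≤ M`) and the rest; bound the inner zone by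
the O'Donnell–Servedio inequality for the exploration from the OUTER sphere (revealment `≤ 2θ_{N−M−1}`) and the rest by
the exploration from the INNER sphere (revealment `≤ 2θ_{M+1−L}`); both trees compute the same crossing.
[cite: DewanMuirhead2022, Prop. 2.2 (d/dp P_p[Cross_k(R)] ≤ cR^{d/2}√(P_p[A_1(R)])/√(p(1−p))) and its proof via Lemma 2.9, Prop. 2.10] -/
theorem sum_pivotal_boxCrossing_le (hd : 1 ≤ d) {L M N : ℕ} (hLM : L ≤ M) (hMN : M + 1 ≤ N) (p : unitInterval)
    (hp0 : 0 < (p : ℝ)) (hp1 : (p : ℝ) < 1) :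
    ∑ z ∈ (box d N).sym2, (bondPercolation (zdGraph d) p).real
        {ω | z ∈ (zdGraph d).edgeSet ∧ IsPivotal (boxCrossing d L N) z ω}
      ≤ 2 * Real.sqrt ((bondPercolation (zdGraph d) p).real (boxCrossing d L N)
          * (1 - (bondPercolation (zdGraph d) p).real (boxCrossing d L N))
          * (4 * d * (2 * (N : ℝ) + 1) ^ d)
          * (bondPercolation (zdGraph d) p).real (siteToBoundary d (min (N - M - 1) (M + 1 - L)))
          / ((p : ℝ) * (1 - p))) := by
  classical
  have hLN : L ≤ N := by omega
  have hb0 : ∀ e, 0 ≤ boxBias d N p e := boxBias_nonneg N p.2.1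
  have hb1 : ∀ e, boxBias d N p e ≤ 1 := boxBias_le_one N p.2.2
  set u : ℝ := (bondPercolation (zdGraph d) p).real (boxCrossing d L N) with hu
  set θm : ℝ := (bondPercolation (zdGraph d) p).real (siteToBoundary d (min (N - M - 1) (M + 1 - L))) with hθm
  set J₁ : Finset (PairIdx d N) := Finset.univ.filter fun e => ∃ a ∈ box d N, a ∈ e.1 ∧ boxNorm a ≤ M with hJ₁
  set J₂ : Finset (PairIdx d N) := Finset.univ \ J₁ with hJ₂
  have hθm0 : 0 ≤ θm := measureReal_nonneg
  -- the common value `A = u` of both trees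
  have hAin : ∑ y, wt (boxBias d N p) y * gcross (latEdge d N) (sphereSeed d N L) (sphereSeed d N N) y = u :=
    sum_wt_gcross_eq hd hLN p
  have hAout : ∑ y, wt (boxBias d N p) y * gcross (latEdge d N) (sphereSeed d N N) (sphereSeed d N L) y = u := by
    rw [← hAin]; exact Finset.sum_congr rfl fun y _ => by rw [gcross_swap]
  -- (A) inner zone, OUTER tree (revealment `≤ 2θ_{N−M−1} ≤ 2θ_m`)
  have hA := sum_piv_le_sqrt (edge := latEdge d N) (latEdge_ends N) (boxBias d N p) hb0 hb1
    (sphereSeed d N N) (sphereSeed d N L) J₁ (R := fun _ => 2 * θm) (fun _ => by positivity)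
    (fun e he a' b' hab => by
      have he' := (mem_innerZone_iff e).1 he
      have h1 := seedProb_outer_le hd hMN p he' hab
      have h2 : (bondPercolation (zdGraph d) p).real (siteToBoundary d (N - M - 1)) ≤ θm :=
        real_siteToBoundary_antitone p (min_le_left _ _)
      linarith)
  rw [hAout] at hA
  simp_rw [pivCross_swap (boxBias d N p) (sphereSeed d N N) (sphereSeed d N L)] at hA
  -- (B) outer zone, INNER tree (revealment `≤ 2θ_{M+1−L} ≤ 2θ_m`)
  have hB := sum_piv_le_sqrt (edge := latEdge d N) (latEdge_ends N) (boxBias d N p) hb0 hb1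
    (sphereSeed d N L) (sphereSeed d N N) J₂ (R := fun _ => 2 * θm) (fun _ => by positivity)
    (fun e he a' b' hab => by
      have he' : ¬ ∃ a ∈ box d N, a ∈ e.1 ∧ boxNorm a ≤ M := by
        intro hex
        have : e ∈ J₁ := (mem_innerZone_iff e).2 hex
        rw [hJ₂, Finset.mem_sdiff] at he
        exact he.2 this
      have h1 := seedProb_inner_le hd hLM p he' hab
      have h2 : (bondPercolation (zdGraph d) p).real (siteToBoundary d (M + 1 - L)) ≤ θm :=
        real_siteToBoundary_antitone p (min_le_right _ _)
      linarith)
  rw [hAin] at hB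
  -- the two zones partition the pairs
  have hsplit : ∑ e : PairIdx d N, boxBias d N p e * (1 - boxBias d N p e)
        * pivCross (latEdge d N) (boxBias d N p) (sphereSeed d N L) (sphereSeed d N N) e
      = (∑ e ∈ J₁, boxBias d N p e * (1 - boxBias d N p e)
          * pivCross (latEdge d N) (boxBias d N p) (sphereSeed d N L) (sphereSeed d N N) e)
        + ∑ e ∈ J₂, boxBias d N p e * (1 - boxBias d N p e)
          * pivCross (latEdge d N) (boxBias d N p) (sphereSeed d N L) (sphereSeed d N N) e := by
    rw [hJ₂, ← Finset.sum_union (Finset.disjoint_sdiff), Finset.union_sdiff_of_subset (Finset.subset_univ _)]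
  -- the bias weights of each zone
  have hW : ∀ J : Finset (PairIdx d N), ∑ e ∈ J, 2 * θm * (boxBias d N p e * (1 - boxBias d N p e))
      ≤ 2 * θm * ((p : ℝ) * (1 - p) * (2 * d * (2 * (N : ℝ) + 1) ^ d)) := by
    intro J
    rw [← Finset.mul_sum]
    exact mul_le_mul_of_nonneg_left (sum_bias_mul_le N p J) (by positivity)
  have hu0 : 0 ≤ u := measureReal_nonneg
  have hu1 : u ≤ 1 := measureReal_le_one
  have huu : 0 ≤ u * (1 - u) := mul_nonneg hu0 (by linarith)
  set X : ℝ := u * (1 - u) * (2 * θm * ((p : ℝ) * (1 - p) * (2 * d * (2 * (N : ℝ) + 1) ^ d))) with hX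
  have hA' : ∑ e ∈ J₁, boxBias d N p e * (1 - boxBias d N p e)
      * pivCross (latEdge d N) (boxBias d N p) (sphereSeed d N L) (sphereSeed d N N) e ≤ Real.sqrt X :=
    hA.trans (Real.sqrt_le_sqrt (mul_le_mul_of_nonneg_left (hW J₁) huu))
  have hB' : ∑ e ∈ J₂, boxBias d N p e * (1 - boxBias d N p e)
      * pivCross (latEdge d N) (boxBias d N p) (sphereSeed d N L) (sphereSeed d N N) e ≤ Real.sqrt X :=
    hB.trans (Real.sqrt_le_sqrt (mul_le_mul_of_nonneg_left (hW J₂) huu))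
  -- identify the left side with `p(1−p)` times Russo's sum
  set S : ℝ := ∑ z ∈ (box d N).sym2, (bondPercolation (zdGraph d) p).real
      {ω | z ∈ (zdGraph d).edgeSet ∧ IsPivotal (boxCrossing d L N) z ω} with hS
  have hlhs : ∑ e : PairIdx d N, boxBias d N p e * (1 - boxBias d N p e)
        * pivCross (latEdge d N) (boxBias d N p) (sphereSeed d N L) (sphereSeed d N N) e
      = (p : ℝ) * (1 - p) * S := by
    rw [Finset.sum_congr rfl (fun e _ => bias_mul_pivCross_eq hd hLN p e), ← Finset.mul_sum, hS,
      ← Finset.sum_coe_sort (box d N).sym2]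
  have hpp : 0 < (p : ℝ) * (1 - p) := mul_pos hp0 (by linarith)
  have hmain : (p : ℝ) * (1 - p) * S ≤ 2 * Real.sqrt X := by
    rw [← hlhs, hsplit]; linarith
  -- `√X = p(1−p)·√Y`
  set Y : ℝ := u * (1 - u) * (4 * d * (2 * (N : ℝ) + 1) ^ d) * θm / ((p : ℝ) * (1 - p)) with hY
  have hXY : X = ((p : ℝ) * (1 - p)) ^ 2 * Y := by
    rw [hX, hY]; field_simp; ring
  have hsqrt : Real.sqrt X = ((p : ℝ) * (1 - p)) * Real.sqrt Y := by
    rw [hXY, Real.sqrt_mul (sq_nonneg _), Real.sqrt_sq hpp.le]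
  rw [hsqrt] at hmain
  have hfin : (p : ℝ) * (1 - p) * S ≤ ((p : ℝ) * (1 - p)) * (2 * Real.sqrt Y) := by linarith
  exact le_of_mul_le_mul_left hfin hpp

/-- **Derivative form** (Russo): for `d ≥ 1`, `L ≤ M`, `M + 1 ≤ N`, `0 < p < 1`, the function
`q ↦ u_q(L,N) = P_q(boxCrossing d L N)` is differentiable at `p` with derivative `D ≥ 0` and
`D ≤ 2·√( u_p(1−u_p) · 4d(2N+1)^d · θ_m(p) / (p(1−p)) )`, `m = min(N−M−1, M+1−L)`, `θ_m = DCT16.thetaN d m`.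
[cite: DewanMuirhead2022, Prop. 2.2] -/
theorem hasDerivAt_real_boxCrossing_le (hd : 1 ≤ d) {L M N : ℕ} (hLM : L ≤ M) (hMN : M + 1 ≤ N) {p : ℝ}
    (hp : p ∈ Set.Ioo (0 : ℝ) 1) :
    ∃ D : ℝ, HasDerivAt (fun q : ℝ => (bondPercolation (zdGraph d) (Set.projIcc 0 1 zero_le_one q)).real
        (boxCrossing d L N)) D p ∧ 0 ≤ D ∧
      D ≤ 2 * Real.sqrt ((bondPercolation (zdGraph d) (Set.projIcc 0 1 zero_le_one p)).real (boxCrossing d L N)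
          * (1 - (bondPercolation (zdGraph d) (Set.projIcc 0 1 zero_le_one p)).real (boxCrossing d L N))
          * (4 * d * (2 * (N : ℝ) + 1) ^ d) * thetaN d (min (N - M - 1) (M + 1 - L)) p / (p * (1 - p))) := by
  classical
  have hpI : p ∈ Set.Icc (0 : ℝ) 1 := ⟨hp.1.le, hp.2.le⟩
  have hproj : Set.projIcc 0 1 zero_le_one p = ⟨p, hpI⟩ := Set.projIcc_of_mem _ hpI
  have hA : IsUpperSet (boxCrossing d L N) := by rw [boxCrossing_eq_linked]; exact isUpperSet_linked _ _ _
  have hF : DeterminedBy (boxCrossing d L N) (↑((box d N).sym2) : Set (Sym2 (Site d))) := by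
    have h1 : DeterminedBy (boxCrossing d L N) (↑(edgesIn (zdGraph d) (box d N)) : Set (Sym2 (Site d))) := by
      rw [boxCrossing_eq_linked]; exact determinedBy_linked_edgesIn _ _ _
    refine h1.mono fun e he => ?_
    exact Finset.mem_coe.2 (Finset.mem_filter.1 (Finset.mem_coe.1 he)).2
  refine ⟨_, russo_formula_sum_holds (zdGraph d) hA ((box d N).sym2) hF p hp,
    Finset.sum_nonneg fun _ _ => measureReal_nonneg, ?_⟩
  rw [hproj, thetaN]
  rw [hproj]
  exact sum_pivotal_boxCrossing_le hd hLM hMN ⟨p, hpI⟩ hp.1 hp.2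

end Summit.CriticalPhenomena.PercolationContinuityZ3.Theorems.CrossingRevealment

end
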